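import Summits.RiemannHypothesis.RiemannHypothesis.Theorems.TiltedLandingLaw421MonovariantSocketB

/-! # TiltedLandingLaw421MonovariantTentC2
c13 C2 tent socket §Q rev b (C2 rh-idea-2 g30): `TentC2.tentSet/tentCount`, `IsTieLowest`, `Anchor0`, `PrefixC2`, `StepC2`, `InitC2`, `CensusStopLowOn`, `censusStopLowOn_of_prefixC2`, `denseLevelCensusStopLow_of_on_split`, `initC2_holds`.
SUPPORT module for crux `TiltedLandingLaw421` (stmt-RiemannHypothesis-24774), `--supports` only: proves no stub, no crux; fully proved (no `sorry`).
Packaged by C4 rh-idea-6 g21 per director (CA239)(1) in the (CA237) lint shape. RH is not proved. -/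

namespace RhW07.C12.FieldSplit

namespace TentC2

open Complex
open RhIdea6.G17.W07C7 RhIdea6.G17.W07C7.Rev6 RhIdea6.G18.W07C8.Law421BirthS RhIdea6.G19.W07C11.Seam
open RhIdea6.G20.W07C12.Frac RhIdea6.G20.W07C12.StColP

/-- a predicate on the DATUM `(η, f, x₀, s, hmax, R, Hs, B)` (no level, no state). -/
abbrev DataPred : Type := ℝ → (ℂ → ℂ) → ℝ → ℝ → ℝ → ℝ → ℝ → ℕ → Prop

/-- the sealed TENT SET at slope `ρ` about the state `v` at level `j`: zeros of `f^{(j)}` other than `v` and `conj v` with `|Re z − Re v| ≤ ρ · Im v`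
(both half-planes and the real axis; no strip or box truncation; no multiplicity). -/
def tentSet (ρ : ℝ) (f : ℂ → ℂ) (j : ℕ) (v : ℂ) : Set ℂ :=
  {z : ℂ | iteratedDeriv j f z = 0 ∧ z ≠ v ∧ z ≠ (starRingEnd ℂ) v ∧ |z.re - v.re| ≤ ρ * v.im}

/-- the sealed METER `T_j(ρ)(v) := Set.ncard (tentSet ρ f j v)` (junk value `0` on an infinite set — never the case on the priced combs). -/
noncomputable def tentCount (ρ : ℝ) (f : ℂ → ℂ) (j : ℕ) (v : ℂ) : ℕ := (tentSet ρ f j v).ncard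

/-- the sealed TIE rule: `v` is a lowest `St`-state at level `j`, nearest to the column `x₀` among the lowest states, leftmost among those. -/
def IsTieLowest (St : StatePred) : StatePred := fun η f x₀ s hmax R Hs B j v =>
  IsLowest St η f x₀ s hmax R Hs B j v ∧
    ∀ w : ℂ, IsLowest St η f x₀ s hmax R Hs B j w → |v.re - x₀| < |w.re - x₀| ∨ (|v.re - x₀| = |w.re - x₀| ∧ v.re ≤ w.re)

/-- the sealed ANCHOR class at constant `c`: every lowest `StCol'` state of level `0` lies within `c·s` of the column. -/
def Anchor0 (c : ℝ) : DataPred := fun η f x₀ s hmax R Hs B =>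
  ∀ v : ℂ, IsLowest StCol' η f x₀ s hmax R Hs B 0 v → |v.re - x₀| ≤ c * s

/-- **(β1″)_C2 — the sealed STEP of l.5165 in its own ∀-signature** (prefix form; `E` = the charged levels, `lam` = the lifts; the prefix inequality is
asserted at every level `k` carrying a tie-lowest state while no level `j' < k` is window-ready; the off-`E` / on-`E` clauses are the census's). -/
def PrefixC2 (ρ c : ℝ) (P : StatePred) : Prop :=
  ∀ (η : ℝ) (f : ℂ → ℂ) (x₀ s hmax R Hs : ℝ) (B : ℕ), EngineHyps5 2 η f x₀ s hmax R Hs B → Anchor0 c η f x₀ s hmax R Hs B →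
    ∃ (E : Finset ℕ) (lam : ℕ → ℝ), (∀ j : ℕ, 0 ≤ lam j) ∧
      (∀ (k : ℕ) (v : ℂ), IsTieLowest StCol' η f x₀ s hmax R Hs B k v →
        (∀ j' : ℕ, j' < k → ¬ WindowReady η f x₀ s hmax R Hs B j' 0) →
          ((E.filter (fun e => e < k)).card : ℝ) + (∑ e ∈ E.filter (fun e => e < k), lam e) / (s / 4)
            + (tentCount ρ f k v : ℝ) ≤ (Hs / s) ^ 2 + B + 1) ∧
      (∀ (j : ℕ) (v : ℂ), j ∉ E → IsLowest StCol' η f x₀ s hmax R Hs B j v → ¬ CumReady WindowReady η f x₀ s hmax R Hs B j v →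
        P η f x₀ s hmax R Hs B j v) ∧
      (∀ (j : ℕ) (u : ℂ), j ∈ E → StCol' η f x₀ s hmax R Hs B j u → ¬ CumReady WindowReady η f x₀ s hmax R Hs B j u →
        ∃ u' : ℂ, StCol' η f x₀ s hmax R Hs B (j + 1) u' ∧ |u'.im| ≤ |u.im| + lam j)

/-- the sealed STEP at its literals: `ρ = 3/2`, anchor `c = 3/8`, dial `PSealC4`. -/
def StepC2 : Prop := PrefixC2 (3 / 2) (3 / 8) PSealC4

/-- **(β2′)_C2 — the sealed INIT**: the `k = 0` instance of the prefix inequality (the tent count of the tie-lowest level-0 state fits in the purse). -/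
def InitC2 (ρ c : ℝ) : Prop :=
  ∀ (η : ℝ) (f : ℂ → ℂ) (x₀ s hmax R Hs : ℝ) (B : ℕ), EngineHyps5 2 η f x₀ s hmax R Hs B → Anchor0 c η f x₀ s hmax R Hs B →
    ∀ v : ℂ, IsTieLowest StCol' η f x₀ s hmax R Hs B 0 v → (tentCount ρ f 0 v : ℝ) ≤ (Hs / s) ^ 2 + B + 1

/-- the priced stopped census RESTRICTED TO A DATA CLASS `A` (same four clauses as `DenseLevelCensusLow`, one extra hypothesis). -/
def CensusLowOn (A : DataPred) (μ cE : ℝ) (P St Ready : StatePred) : Prop :=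
  ∀ (η : ℝ) (f : ℂ → ℂ) (x₀ s hmax R Hs : ℝ) (B : ℕ), EngineHyps5 2 η f x₀ s hmax R Hs B → A η f x₀ s hmax R Hs B →
    ∃ (E : Finset ℕ) (lam : ℕ → ℝ), (∀ j : ℕ, 0 ≤ lam j) ∧
      (E.card : ℝ) + (∑ e ∈ E, lam e) / (μ * s) ≤ (Hs / s) ^ 2 + B + cE ∧
      (∀ (j : ℕ) (v : ℂ), j ∉ E → IsLowest St η f x₀ s hmax R Hs B j v → ¬ Ready η f x₀ s hmax R Hs B j v →
        P η f x₀ s hmax R Hs B j v) ∧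
      (∀ (j : ℕ) (u : ℂ), j ∈ E → St η f x₀ s hmax R Hs B j u → ¬ Ready η f x₀ s hmax R Hs B j u →
        ∃ u' : ℂ, St η f x₀ s hmax R Hs B (j + 1) u' ∧ |u'.im| ≤ |u.im| + lam j)

/-- the node's literals on a class. -/
def CensusStopLowOn (A : DataPred) (P : StatePred) : Prop := CensusLowOn A (1 / 4) 1 P StCol' (CumReady WindowReady)

/-- (K) the class version with `A` certified for every datum IS the registered node (β-low). -/
theorem denseLevelCensusStopLow_of_on {A : DataPred} {P : StatePred} (h : CensusStopLowOn A P)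
    (hA : ∀ (η : ℝ) (f : ℂ → ℂ) (x₀ s hmax R Hs : ℝ) (B : ℕ), EngineHyps5 2 η f x₀ s hmax R Hs B → A η f x₀ s hmax R Hs B) :
    DenseLevelCensusStopLow P :=
  fun η f x₀ s hmax R Hs B hE => h η f x₀ s hmax R Hs B hE (hA η f x₀ s hmax R Hs B hE)

/-- (K) conversely the node gives the class version for any class. -/
theorem censusStopLowOn_of_denseLevelCensusStopLow {A : DataPred} {P : StatePred} (h : DenseLevelCensusStopLow P) :
    CensusStopLowOn A P :=
  fun η f x₀ s hmax R Hs B hE _ => h η f x₀ s hmax R Hs B hE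

/-- (K) **the COMPLEMENT token** (critic E4 l.5195, REACH of entry 4): the node (β-low) SPLITS along any data class `A` into two
class-restricted copies — `CensusStopLowOn A P ∧ CensusStopLowOn (¬A) P → DenseLevelCensusStopLow P` — so an anchored route (entry 4, `A := Anchor0 (3/8)`)
and an off-anchor route (e.g. entry 3's discount, or re-booking at the far column) are two stubs whose conjunction is the registered node, each quantifying
over strictly fewer data. -/
theorem denseLevelCensusStopLow_of_on_split (A : DataPred) {P : StatePred} (hOn : CensusStopLowOn A P)
    (hOff : CensusStopLowOn (fun η f x₀ s hmax R Hs B => ¬ A η f x₀ s hmax R Hs B) P) : DenseLevelCensusStopLow P := by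
  intro η f x₀ s hmax R Hs B hE
  by_cases hA : A η f x₀ s hmax R Hs B
  · exact hOn η f x₀ s hmax R Hs B hE hA
  · exact hOff η f x₀ s hmax R Hs B hE hA

/-- (K) **(β1″)_C2 ⇒ (β2′)_C2**: the `k = 0` instance. -/
theorem initC2_of_prefixC2 {ρ c : ℝ} {P : StatePred} (h : PrefixC2 ρ c P) : InitC2 ρ c := by
  intro η f x₀ s hmax R Hs B hE hA v hv
  obtain ⟨E, lam, -, hpre, -, -⟩ := h η f x₀ s hmax R Hs B hE hA
  have h0 := hpre 0 v hv (fun j' hj' => absurd hj' (Nat.not_lt_zero j'))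
  have hfil : E.filter (fun e => e < 0) = ∅ := by
    rw [Finset.filter_eq_empty_iff]
    intro e _; exact Nat.not_lt_zero e
  rw [hfil] at h0
  simpa using h0

/-- (K) the window-ready predicate ignores the state argument. -/
theorem windowReady_irrel {η : ℝ} {f : ℂ → ℂ} {x₀ s hmax R Hs : ℝ} {B j : ℕ} (u w : ℂ) :
    WindowReady η f x₀ s hmax R Hs B j u ↔ WindowReady η f x₀ s hmax R Hs B j w := Iff.rfl

/-- (K) a TIE-LOWEST state exists at every populated level (finiteness of the level set, `hasLowestSig_stCol'`). -/
theorem exists_isTieLowest {η : ℝ} {f : ℂ → ℂ} {x₀ s hmax R Hs : ℝ} {B j : ℕ} {u : ℂ}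
    (hE : EngineHyps5 2 η f x₀ s hmax R Hs B) (hu : StCol' η f x₀ s hmax R Hs B j u) :
    ∃ v : ℂ, IsTieLowest StCol' η f x₀ s hmax R Hs B j v := by
  obtain ⟨v₀, hv₀⟩ := hasLowestSig_stCol' η f x₀ s hmax R Hs B hE j u hu
  -- the lowest states form a finite nonempty set
  have hfin : {w : ℂ | IsLowest StCol' η f x₀ s hmax R Hs B j w}.Finite :=
    (stColP_level_finite hE j).subset (fun w hw => hw.1)
  have hne : {w : ℂ | IsLowest StCol' η f x₀ s hmax R Hs B j w}.Nonempty := ⟨v₀, hv₀⟩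
  -- step 1: minimise the distance to the column
  obtain ⟨v₁, hv₁, hmin₁⟩ := hfin.exists_minimalFor (fun w => |w.re - x₀|) _ hne
  have hd : ∀ w : ℂ, IsLowest StCol' η f x₀ s hmax R Hs B j w → |v₁.re - x₀| ≤ |w.re - x₀| := by
    intro w hw
    by_contra hlt
    rw [not_le] at hlt
    exact absurd (hmin₁ hw hlt.le) (not_le.mpr hlt)
  -- step 2: among the nearest ones, minimise the real part
  have hfin' : {w : ℂ | IsLowest StCol' η f x₀ s hmax R Hs B j w ∧ |w.re - x₀| = |v₁.re - x₀|}.Finite :=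
    hfin.subset (fun w hw => hw.1)
  have hne' : {w : ℂ | IsLowest StCol' η f x₀ s hmax R Hs B j w ∧ |w.re - x₀| = |v₁.re - x₀|}.Nonempty := ⟨v₁, hv₁, rfl⟩
  obtain ⟨v, ⟨hv, hvd⟩, hmin⟩ := hfin'.exists_minimalFor Complex.re _ hne'
  have hr : ∀ w : ℂ, IsLowest StCol' η f x₀ s hmax R Hs B j w → |w.re - x₀| = |v₁.re - x₀| → v.re ≤ w.re := by
    intro w hw hwd
    by_contra hlt
    rw [not_le] at hlt
    exact absurd (hmin ⟨hw, hwd⟩ hlt.le) (not_le.mpr hlt)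
  refine ⟨v, hv, fun w hw => ?_⟩
  rcases lt_or_eq_of_le (hvd ▸ hd w hw) with hlt | heq
  · exact Or.inl hlt
  · exact Or.inr ⟨heq, hr w hw (heq.symm.trans hvd)⟩

/-- ★★ **(K) (β1″)_C2 ⇒ the priced stopped census ON THE ANCHOR CLASS.**  `E' :=` the levels of `E` that carry a not-ready state; the budget
comes from the prefix inequality at `k := max E' + 1`, a level which is populated (on-`E` successor clause) hence carries a tie-lowest state, and below
which no level is window-ready (the state at `max E'` is not cumulatively ready and `WindowReady` ignores the state). -/
theorem censusStopLowOn_of_prefixC2 {ρ c : ℝ} {P : StatePred} (h : PrefixC2 ρ c P) : CensusStopLowOn (Anchor0 c) P := by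
  intro η f x₀ s hmax R Hs B hE hA
  classical
  have hs : 0 < s := hE.2.2.2.1
  obtain ⟨E, lam, hlam0, hpre, hoff, hon⟩ := h η f x₀ s hmax R Hs B hE hA
  -- the live part of E
  set G : Finset ℕ := E.filter (fun j => ∃ u : ℂ, StCol' η f x₀ s hmax R Hs B j u ∧ ¬ CumReady WindowReady η f x₀ s hmax R Hs B j u)
    with hGdef
  have hGE : ∀ j : ℕ, j ∈ G → j ∈ E := fun j hj => (Finset.mem_filter.1 hj).1
  have hoffG : ∀ (j : ℕ) (v : ℂ), j ∉ G → IsLowest StCol' η f x₀ s hmax R Hs B j v →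
      ¬ CumReady WindowReady η f x₀ s hmax R Hs B j v → P η f x₀ s hmax R Hs B j v := by
    intro j v hjG hlow hnr
    by_cases hjE : j ∈ E
    · exact absurd (Finset.mem_filter.2 ⟨hjE, v, hlow.1, hnr⟩) hjG
    · exact hoff j v hjE hlow hnr
  have honG : ∀ (j : ℕ) (u : ℂ), j ∈ G → StCol' η f x₀ s hmax R Hs B j u → ¬ CumReady WindowReady η f x₀ s hmax R Hs B j u →
      ∃ u' : ℂ, StCol' η f x₀ s hmax R Hs B (j + 1) u' ∧ |u'.im| ≤ |u.im| + lam j :=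
    fun j u hj => hon j u (hGE j hj)
  have hpurse0 : (0 : ℝ) ≤ (Hs / s) ^ 2 + B + 1 := by positivity
  by_cases hG : G.Nonempty
  · -- k := max G + 1 is populated and nothing below it is window-ready
    set m : ℕ := G.max' hG with hmdef
    have hmG : m ∈ G := Finset.max'_mem G hG
    obtain ⟨-, um, hum, hnrm⟩ := Finset.mem_filter.1 hmG
    obtain ⟨u', hu', -⟩ := hon m um (hGE m hmG) hum hnrm
    obtain ⟨v, hv⟩ := exists_isTieLowest hE hu'
    have hWR : ∀ j' : ℕ, j' < m + 1 → ¬ WindowReady η f x₀ s hmax R Hs B j' 0 := by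
      intro j' hj' hW
      exact hnrm ⟨j', Nat.le_of_lt_succ hj', (windowReady_irrel 0 um).1 hW⟩
    have hk := hpre (m + 1) v hv hWR
    -- G ⊆ E ∩ [0, m]
    have hsub : G ⊆ E.filter (fun e => e < m + 1) := by
      intro j hj
      exact Finset.mem_filter.2 ⟨hGE j hj, Nat.lt_succ_of_le (Finset.le_max' G j hj)⟩
    have hcard : (G.card : ℝ) ≤ ((E.filter (fun e => e < m + 1)).card : ℝ) := by
      exact_mod_cast Finset.card_le_card hsub
    have hsum : (∑ e ∈ G, lam e) ≤ ∑ e ∈ E.filter (fun e => e < m + 1), lam e :=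
      Finset.sum_le_sum_of_subset_of_nonneg hsub (fun e _ _ => hlam0 e)
    have hT : (0 : ℝ) ≤ (tentCount ρ f (m + 1) v : ℝ) := Nat.cast_nonneg _
    have hs4 : 0 < s / 4 := by linarith
    have hdiv : (∑ e ∈ G, lam e) / (s / 4) ≤ (∑ e ∈ E.filter (fun e => e < m + 1), lam e) / (s / 4) :=
      div_le_div_of_nonneg_right hsum hs4.le
    refine ⟨G, lam, hlam0, ?_, hoffG, honG⟩
    have hμ : (1 / 4 : ℝ) * s = s / 4 := by ring
    rw [hμ]
    linarith
  · -- no live charged level: E' := ∅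
    rw [Finset.not_nonempty_iff_eq_empty] at hG
    refine ⟨G, lam, hlam0, ?_, hoffG, honG⟩
    rw [hG]
    simpa using hpurse0

/-- ★ (K) at the literals: the sealed STEP gives the registered node's (β-low) on the anchor class `|Re v₀ − x₀| ≤ 3s/8`. -/
theorem censusStopLowOn_of_stepC2 (h : StepC2) : CensusStopLowOn (Anchor0 (3 / 8)) PSealC4 :=
  censusStopLowOn_of_prefixC2 h

/-- (K) at entry 4's literals: `StepC2` plus ANY certificate of the census off the anchor class gives the node. -/
theorem denseLevelCensusStopLow_of_stepC2_offAnchor (h : StepC2)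
    (hOff : CensusStopLowOn (fun η f x₀ s hmax R Hs B => ¬ Anchor0 (3 / 8) η f x₀ s hmax R Hs B) PSealC4) :
    DenseLevelCensusStopLow PSealC4 :=
  denseLevelCensusStopLow_of_on_split (Anchor0 (3 / 8)) (censusStopLowOn_of_prefixC2 h) hOff

/-- ★ (K) hence, with an anchor certificate for every datum, the node itself and the c13 chain. -/
theorem denseLevelCensusStopLow_of_stepC2 (h : StepC2)
    (hA : ∀ (η : ℝ) (f : ℂ → ℂ) (x₀ s hmax R Hs : ℝ) (B : ℕ), EngineHyps5 2 η f x₀ s hmax R Hs B → Anchor0 (3 / 8) η f x₀ s hmax R Hs B) :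
    DenseLevelCensusStopLow PSealC4 :=
  denseLevelCensusStopLow_of_on (censusStopLowOn_of_stepC2 h) hA

/-- (K) zeros of an entire `g ≢ 0` have positive finite order: `1 ≤ (analyticOrderAt g u).toNat`. -/
theorem one_le_analyticOrderAt_toNat {g : ℂ → ℂ} (hg : Differentiable ℂ g) (hne : g ≠ 0) {u : ℂ} (hu : g u = 0) :
    1 ≤ (analyticOrderAt g u).toNat := by
  have hga : AnalyticAt ℂ g u := hg.analyticAt u
  have hntop : analyticOrderAt g u ≠ ⊤ := by
    intro htop
    have huniv : AnalyticOnNhd ℂ g Set.univ := fun z _ => hg.analyticAt z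
    have hall := huniv.eqOn_zero_of_preconnected_of_eventuallyEq_zero isPreconnected_univ (Set.mem_univ u)
      (analyticOrderAt_eq_top.mp htop)
    exact hne (funext fun z => hall (Set.mem_univ z))
  have hne0 : analyticOrderAt g u ≠ 0 := by
    rw [Ne, hga.analyticOrderAt_eq_zero]; exact fun h => h hu
  obtain ⟨n, hn⟩ := ENat.ne_top_iff_exists.mp hntop
  rw [← hn] at hne0 ⊢
  have hn0 : n ≠ 0 := fun h0 => hne0 (by simp [h0])
  simp only [ENat.toNat_coe]
  exact Nat.one_le_iff_ne_zero.mpr hn0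

/-- ★ (K) the COLUMN COUNT behind INIT: for a level-0 state `v`, a slope `ρ ≥ 0` and any admissible radius `r ∈ [s, R]` with
`|Re v − x₀| + ρ·Im v ≤ r`, the tent set, `v` and `conj v` are distinct zeros of `f` within `|Re u − x₀| ≤ r`, each of multiplicity `≥ 1`,
so `ColumnBudgetMult` yields `T₀(v) + 2 ≤ 2r/s + B`. -/
theorem tentCount_zero_add_two_le {η : ℝ} {f : ℂ → ℂ} {x₀ s hmax R Hs : ℝ} {B : ℕ} (hE : EngineHyps5 2 η f x₀ s hmax R Hs B)
    {v : ℂ} (hv : StCol' η f x₀ s hmax R Hs B 0 v) {ρ r : ℝ} (hρ : 0 ≤ ρ) (hsr : s ≤ r) (hrR : r ≤ R)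
    (hvr : |v.re - x₀| + ρ * v.im ≤ r) :
    (tentCount ρ f 0 v : ℝ) + 2 ≤ 2 * r / s + B := by
  obtain ⟨hdiff, hreal, -, hs, -, -, -, -, hstrip, -, -, hcol, -, -, -, -⟩ := hE
  obtain ⟨hf0', hfv', hvim, -, -⟩ := hv
  rw [iteratedDeriv_zero] at hf0' hfv'
  -- the column set of radius r is finite
  set Z : Set ℂ := {u : ℂ | f u = 0 ∧ |u.re - x₀| ≤ r} with hZdef
  have hZfin : Z.Finite := by
    refine (finite_zeros_closedBall_of_entire hdiff hf0' (x₀ : ℂ) (r + Hs)).subset ?_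
    intro u hu
    obtain ⟨hu0, hure⟩ := hu
    refine ⟨?_, hu0⟩
    rw [Metric.mem_closedBall, dist_eq_norm]
    have h1 : ‖u - (x₀ : ℂ)‖ ≤ |(u - (x₀ : ℂ)).re| + |(u - (x₀ : ℂ)).im| := Complex.norm_le_abs_re_add_abs_im _
    have h2 : (u - (x₀ : ℂ)).re = u.re - x₀ := by simp
    have h3 : (u - (x₀ : ℂ)).im = u.im := by simp
    rw [h2, h3] at h1
    have h4 := hstrip u hu0
    have h5 : u.im ≤ Hs := le_trans (le_abs_self _) h4
    have h6 : |u.im| ≤ Hs := h4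
    linarith
  -- v and conj v are distinct members of Z
  have hρy : 0 ≤ ρ * v.im := mul_nonneg hρ hvim.le
  have hvre : |v.re - x₀| ≤ r := by linarith
  have hvZ : v ∈ Z := ⟨hfv', hvre⟩
  have hconj : f ((starRingEnd ℂ) v) = 0 := by
    rw [Literature.Analysis.Complex.apply_conj_eq_conj hdiff hreal, hfv', map_zero]
  have hcZ : (starRingEnd ℂ) v ∈ Z := ⟨hconj, by rwa [Complex.conj_re]⟩
  have hvc : v ≠ (starRingEnd ℂ) v := by
    intro h
    have him : v.im = ((starRingEnd ℂ) v).im := by rw [← h]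
    rw [Complex.conj_im] at him
    linarith
  -- the tent set is inside Z and misses {v, conj v}
  have hTZ : tentSet ρ f 0 v ⊆ Z := by
    intro z hz
    obtain ⟨hz0, -, -, hzre⟩ := hz
    rw [iteratedDeriv_zero] at hz0
    refine ⟨hz0, ?_⟩
    have := abs_sub_le (z.re) (v.re) x₀
    linarith
  have hdisj : Disjoint (tentSet ρ f 0 v) ({v, (starRingEnd ℂ) v} : Set ℂ) := by
    rw [Set.disjoint_left]
    intro z hz hz'
    rcases hz' with h | h
    · exact hz.2.1 h
    · exact hz.2.2.1 h
  have hpairZ : ({v, (starRingEnd ℂ) v} : Set ℂ) ⊆ Z := by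
    intro z hz
    rcases hz with h | h
    · rw [h]; exact hvZ
    · rw [Set.mem_singleton_iff] at h; rw [h]; exact hcZ
  have hUZ : tentSet ρ f 0 v ∪ {v, (starRingEnd ℂ) v} ⊆ Z := Set.union_subset hTZ hpairZ
  have hTfin : (tentSet ρ f 0 v).Finite := hZfin.subset hTZ
  have hU : (tentSet ρ f 0 v ∪ {v, (starRingEnd ℂ) v}).ncard = tentCount ρ f 0 v + 2 := by
    rw [Set.ncard_union_eq hdisj hTfin (Set.toFinite _), Set.ncard_pair hvc]
    rfl
  have hle : tentCount ρ f 0 v + 2 ≤ Z.ncard := by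
    rw [← hU]; exact Set.ncard_le_ncard hUZ hZfin
  -- count ≤ multiplicity sum ≤ 2r/s + B
  have hcount : (Z.ncard : ℝ) ≤ ∑ᶠ u ∈ Z, ((analyticOrderAt f u).toNat : ℝ) := by
    rw [finsum_mem_eq_finite_toFinset_sum (fun u => ((analyticOrderAt f u).toNat : ℝ)) hZfin, Set.ncard_eq_toFinset_card Z hZfin]
    have h1 : ∀ u ∈ hZfin.toFinset, (1 : ℝ) ≤ ((analyticOrderAt f u).toNat : ℝ) := by
      intro u hu
      rw [Set.Finite.mem_toFinset] at hu
      exact_mod_cast one_le_analyticOrderAt_toNat hdiff hf0' hu.1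
    calc (hZfin.toFinset.card : ℝ) = ∑ u ∈ hZfin.toFinset, (1 : ℝ) := by simp
      _ ≤ ∑ u ∈ hZfin.toFinset, ((analyticOrderAt f u).toNat : ℝ) := Finset.sum_le_sum h1
  have hB := hcol r hsr hrR
  have hle' : ((tentCount ρ f 0 v + 2 : ℕ) : ℝ) ≤ (Z.ncard : ℝ) := by exact_mod_cast hle
  push_cast at hle'
  linarith

/-- ★★ **(K) THE SEALED INIT HOLDS: `InitC2 (3/2) (3/8)`** — on the anchor class `|Re v₀ − x₀| ≤ 3s/8` the 3/2-tent count of the (tie-)lowest level-0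
state fits in the purse, from `ColumnBudgetMult` alone (radius `r := max s (|Re v₀ − x₀| + (3/2)·Im v₀) ≤ R`; slack `(Im v₀/s − 3/2)² ≥ 0` in the
case `r > s`, slack `(Hs/s)² + 1` in the case `r = s`).  No heredity, no pair field, no stub is used. -/
theorem initC2_holds : InitC2 (3 / 2) (3 / 8) := by
  intro η f x₀ s hmax R Hs B hE hA v hv
  have hE' := hE
  obtain ⟨-, -, -, hs, h2s, h2h, -, hHs0, -, hHsR, -, -, -, -, -, -⟩ := hE'
  have hlow : IsLowest StCol' η f x₀ s hmax R Hs B 0 v := hv.1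
  have hSt : StCol' η f x₀ s hmax R Hs B 0 v := hlow.1
  have hvim : 0 < v.im := hSt.2.2.1
  have hvHs : v.im ≤ Hs := hSt.2.2.2.2
  have hd : |v.re - x₀| ≤ 3 / 8 * s := hA v hlow
  have hd0 : 0 ≤ |v.re - x₀| := abs_nonneg _
  -- the radius
  set r : ℝ := max s (|v.re - x₀| + 3 / 2 * v.im) with hrdef
  have hsr : s ≤ r := le_max_left _ _
  have hvr : |v.re - x₀| + 3 / 2 * v.im ≤ r := le_max_right _ _
  have hrR : r ≤ R := by
    rcases le_total s (|v.re - x₀| + 3 / 2 * v.im) with h | h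
    · rw [hrdef, max_eq_right h]; nlinarith
    · rw [hrdef, max_eq_left h]; nlinarith
  have hT := tentCount_zero_add_two_le hE hSt (by norm_num : (0 : ℝ) ≤ 3 / 2) hsr hrR hvr
  -- 2r/s ≤ (Hs/s)² + 3
  have hkey : 2 * r / s ≤ (Hs / s) ^ 2 + 3 := by
    rcases le_total s (|v.re - x₀| + 3 / 2 * v.im) with h | h
    · rw [hrdef, max_eq_right h]
      have ht : 0 < v.im / s := div_pos hvim hs
      have htT : v.im / s ≤ Hs / s := div_le_div_of_nonneg_right hvHs hs.le
      have ht2 : (v.im / s) ^ 2 ≤ (Hs / s) ^ 2 := pow_le_pow_left₀ ht.le htT 2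
      have hds : |v.re - x₀| / s ≤ 3 / 8 := by
        rw [div_le_iff₀ hs]; linarith
      have hsplit : 2 * (|v.re - x₀| + 3 / 2 * v.im) / s = 2 * (|v.re - x₀| / s) + 3 * (v.im / s) := by
        rw [show 2 * (|v.re - x₀| + 3 / 2 * v.im) = 2 * |v.re - x₀| + 3 * v.im by ring, add_div, mul_div_assoc, mul_div_assoc]
      rw [hsplit]
      nlinarith [sq_nonneg (v.im / s - 3 / 2)]
    · rw [hrdef, max_eq_left h]
      have h2 : 2 * s / s = 2 := by field_simp
      rw [h2]
      nlinarith [sq_nonneg (Hs / s)]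
  linarith

end TentC2

end RhW07.C12.FieldSplit
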